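import Summits.Langlands.Langlands.Statement
import Summits.Langlands.Langlands.Theses.DyadicOddResidue
import Summits.Langlands.Langlands.Theorems.DyadicOddResidueOddPrimesRegularFMOfXZhang
import Literature.NumberTheory.GaloisRepresentations.SymplecticMultiplier
import Literature.NumberTheory.GaloisRepresentations.GSpValued
import HarnessLib

/-!
# Witness (F3 / BC5) for the rung `SymplecticOddAbelianQ 2` of line `SymplecticOddAbelianQ2`
# (crux `ReciprocityUpToIrreducibility`, item stmt-Langlands-14328; G4 ladder-down, generation 8)

The rung family `SymplecticOddAbelianQ g` (VERBATIM the definition in `Lines/SymplecticOddAbelianQ2.lean`)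
SPECIALISES at the floor parameter `g = 1` — where the abelian Hodge type `{a, a+1}` is multiplicity-free,
i.e. REGULAR — to the tree theorem
`Summit.Langlands.Langlands.Theorems.oddPrimesRegularFM_of_XZhang2024_tateTwist`
(`Theorems/DyadicOddResidueOddPrimesRegularFMOfXZhang.lean`; item `DyadicOddResidue.OddPrimesRegularFM`,
stmt-Langlands-18743): Fontaine–Mazur for `GL₂/ℚ` in the regular case at every odd prime (Kisin 2009,
Emerton 2011, Skinner–Wiles 1999, Hu–Tan 2015, Pan 2022 Thm. 1.0.4, X. Zhang 2024 Thm. 1.0.2, with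
Khare–Wintenberger) — conditional on exactly the one named Literature fact
`XZhang2024_fontaineMazurGL2_tateTwist`, carried as the hypothesis of the example; NO `sorry`.
Two conversions, both proved here: (i) the polarization clause — in rank 2 every `ρ` is symplectic with
multiplier `det ρ` (`FramedGaloisRep.isSymplecticWithMultiplierFun_two_det`) and the multiplier of a
rank-2 similitude is unique in characteristic 0 (`diag_eq_zero_of_transpose_eq_neg`,
`FramedGaloisRep.isOdd_iff_multiplier`), so "symplectic with an odd multiplier" gives Serre's
`det ρ(c) = -1` (`isOdd_of_symplectic_odd`, as in generation 4's `Lines/SymplecticOddRegularQ2_special.lean`);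
(ii) the weight clause — `Multiset.replicate 1 a + Multiset.replicate 1 (a+1) = {a, a+1}` is `Nodup`
(`nodup_replicate_one_add`), which is the floor item's regularity hypothesis.
witness_regime: g = 1 (n = 2), F = ℚ, ℓ odd, ρ irreducible, GSp-odd, de Rham with labelled Hodge–Tate
weights `{a, a+1}` at the place above ℓ.  S known there: the (B)-clause of S on exactly this cell IS the
floor theorem (F9: literal specialisation `SymplecticOddAbelianQ 1`).  Calibration OUTSIDE S's known
regime inside the rung g = 2 (abelian-surface type, HT `{a,a,a+1,a+1}`, IRREGULAR): the cells decided in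
print are (α) `ρ = ρ_{A,p}` for an abelian surface `A/ℚ` with `ρ̄_{A,3}` onto `GSp₄(𝔽₃)`, good ordinary
3-distinguished reduction at 3 and a condition at 2 (Boxer–Calegari–Gee–Pilloni 2025, Thm. 1 —
arXiv:2502.20645 p. 3), (β) ordinary `p`-distinguished `ρ` with vast-and-tidy, residually ORDINARILY
MODULAR `ρ̄` (Boxer–Calegari–Gee–Pilloni 2021, the modularity lifting theorem of the introduction —
arXiv:1812.09269 p. 4), (γ) residually Saito–Kurokawa-reducible `ρ` under an `R = T`-type hypothesis
(Berger–Klosin 2020); (B) for abelian-surface-type `ρ` over ℚ in general — non-ordinary at ℓ, or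
residually not known modular (every `p ≥ 5` with big image), or not arising from a known abelian
surface — is OPEN ("Deducing residual modularity in irregular weight from regular weight … we do not
know how to do this", arXiv:2502.20645 p. 4).
-/

noncomputable section

set_option linter.dupNamespace false

open scoped MatrixGroups Matrix NumberField Classical Polynomial
open Filter IsDedekindDomain Field Polynomial
open Literature.NumberTheory.Automorphic Literature.NumberTheory.GaloisRepresentations
open Literature.NumberTheory.PAdicHodge
open Summit.Langlands

namespace Summit.Langlands.Langlands.Cruxes.ReciprocityUpToIrreducibility.SymplecticOddAbelianQ2.Special

/-- **The rung family** (dial = abelian genus `g`, rank `2g`): clause (B) of the summit over `ℚ`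
restricted to the symplectic-odd Fontaine–Mazur sector of ABELIAN HODGE TYPE at odd `ℓ` —
`ρ : Γ_ℚ → GL_{2g}(ℚ̄_ℓ)` irreducible, preserving a non-degenerate alternating form up to a multiplier
`μ` with `μ(c) = -1` at complex conjugation (GSp-oddness, Boxer–Calegari–Gee–Pilloni 2021 §7.6),
unramified a.e., de Rham at `ℓ` for the PINNED Fontaine datum `fontainePstAdicCompletion v ℓ hv` with,
at every label, Hodge–Tate multiset `{a,…,a, a+1,…,a+1}` (`g` copies each; `a ∈ ℤ` free — both sign
conventions) — conclusion: an L-algebraic cuspidal `π` of `GL_{2g}(𝔸_ℚ)` with Satake–Frobenius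
matching at almost all places.  `g = 1`: regular weight, the tree's `OddPrimesRegularFM` restricted to
consecutive weights; `g = 2`: abelian-surface type, IRREGULAR (`{a,a,a+1,a+1}`).
[cite: BoxerEtAl2021, §7.6] [cite: FontaineMazurGeometric1995, Conj. 1] -/
def SymplecticOddAbelianQ (g : ℕ) : Prop :=
  ∀ (ℓ : ℕ) [Fact ℓ.Prime], ℓ ≠ 2 →
    ∀ (ρ : Literature.NumberTheory.GaloisRepresentations.FramedGaloisRep ℚ (PadicAlgCl ℓ) (2 * g)),
      ρ.toGaloisRep.IsIrreducible →
      (∃ μ : Field.absoluteGaloisGroup ℚ → PadicAlgCl ℓ, ρ.IsSymplecticWithMultiplierFun μ ∧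
        ∀ (φ : ℚ →+* ℝ) (c : Field.absoluteGaloisGroup ℚ),
          Literature.NumberTheory.GaloisRepresentations.IsComplexConjugation φ c → μ c = -1) →
      (∀ᶠ v : IsDedekindDomain.HeightOneSpectrum (NumberField.RingOfIntegers ℚ) in Filter.cofinite,
        ρ.IsUnramifiedAt v) →
      (∀ (v : IsDedekindDomain.HeightOneSpectrum (NumberField.RingOfIntegers ℚ))
        (hv : ((ℓ : ℕ) : NumberField.RingOfIntegers ℚ) ∈ v.asIdeal),
        (Literature.NumberTheory.PAdicHodge.fontainePstAdicCompletion v ℓ hv).IsDeRhamFramed (ρ.toLocal v) ∧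
        ∀ τ : v.adicCompletion ℚ →+* PadicAlgCl ℓ, Continuous τ →
          ∃ a : ℤ, ρ.labelledHodgeTateWeightsAt v
            (Literature.NumberTheory.PAdicHodge.fontainePstAdicCompletion v ℓ hv).algebra
            (Literature.NumberTheory.PAdicHodge.fontainePstAdicCompletion v ℓ hv).𝔅 τ =
            Multiset.replicate g a + Multiset.replicate g (a + 1)) →
      ∀ (hcpt : Literature.NumberTheory.Automorphic.isCompact_glFiniteIntegralLevel (2 * g) ℚ)
        (ι : PadicAlgCl ℓ ≃+* ℂ),
        ∃ π : Literature.NumberTheory.Automorphic.CuspidalAutomorphicRepData (2 * g) ℚ hcpt,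
          π.1.IsLAlgebraic ∧
          ∀ᶠ v : IsDedekindDomain.HeightOneSpectrum (NumberField.RingOfIntegers ℚ) in Filter.cofinite,
            Summit.Langlands.SatakeFrobCompatibleAt ι π.1 ρ v

/-- **THE RUNG** (the filed statement): the family at genus `g = 2` — reciprocity (B) for irreducible,
odd-symplectic (`GSp₄`-type) `ρ : Γ_ℚ → GL₄(ℚ̄_ℓ)` of abelian-surface Hodge type `{a,a,a+1,a+1}`,
`ℓ` odd: the Fontaine–Mazur–Langlands form of the paramodular (Brumer–Kramer) conjecture.
[cite: BoxerEtAl2021, Thm. 1.1.3] [cite: BoxerCalegariGeePilloni2025, Thm. 1.1] -/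
def SymplecticOddAbelianQ2 : Prop := SymplecticOddAbelianQ 2

section Floor

/-- Over a characteristic-zero domain an antisymmetric matrix has zero diagonal
(copied from `Lines/SymplecticOddRegularQ2_special.lean`, generation 4). [folklore] -/
theorem diag_eq_zero_of_transpose_eq_neg {A : Type*} [CommRing A] [NoZeroDivisors A] [CharZero A]
    {m : ℕ} {J : Matrix (Fin m) (Fin m) A} (hJt : Jᵀ = -J) (i : Fin m) : J i i = 0 := by
  have h := congrFun (congrFun hJt i) i
  simp only [Matrix.transpose_apply, Matrix.neg_apply] at h
  have h2 : (2 : A) * J i i = 0 := by linear_combination h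
  rcases mul_eq_zero.mp h2 with h2 | h2
  · exact absurd h2 two_ne_zero
  · exact h2

/-- In rank `2` (`GSp₂ = GL₂`) GSp-oddness of the multiplier IS Serre's oddness `det ρ(c) = -1`
(generation 4's bridge, re-proved verbatim). [cite: BoxerEtAl2021, §7.6] [folklore] -/
theorem isOdd_of_symplectic_odd {ℓ : ℕ} [Fact ℓ.Prime]
    (ρ : Literature.NumberTheory.GaloisRepresentations.FramedGaloisRep ℚ (PadicAlgCl ℓ) 2)
    (h : ∃ μ : Field.absoluteGaloisGroup ℚ → PadicAlgCl ℓ, ρ.IsSymplecticWithMultiplierFun μ ∧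
      ∀ (φ : ℚ →+* ℝ) (c : Field.absoluteGaloisGroup ℚ),
        Literature.NumberTheory.GaloisRepresentations.IsComplexConjugation φ c → μ c = -1) :
    ρ.IsOdd := by
  obtain ⟨μ, ⟨J, hJt, hJu, hJ⟩, hμ⟩ := h
  exact (FramedGaloisRep.isOdd_iff_multiplier hJu.ne_zero hJt
    (fun i => diag_eq_zero_of_transpose_eq_neg hJt i) hJ (by decide)).mpr hμ

/-- Consecutive weights `{a, a+1}` are multiplicity-free. [folklore] -/
theorem nodup_replicate_one_add (a : ℤ) :
    (Multiset.replicate 1 a + Multiset.replicate 1 (a + 1)).Nodup := by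
  simp [Multiset.nodup_cons]

/-- **The floor of the ladder** (`g = 1`) from the tree theorem
`Theorems.oddPrimesRegularFM_of_XZhang2024_tateTwist` (item `DyadicOddResidue.OddPrimesRegularFM`,
stmt-Langlands-18743): at `g = 1` the abelian Hodge type `{a, a+1}` is REGULAR, so the floor applies.
[cite: XZhang2024FontaineMazurP3, Thm. 1.0.2] [cite: Pan2022, Thm. 1.0.4] [cite: Kisin2009] -/
theorem floor_one (hXZ : XZhang2024_fontaineMazurGL2_tateTwist) : SymplecticOddAbelianQ 1 := by
  intro ℓ _ hℓ ρ hirr hsymp hunr hdR hcpt ι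
  refine Summit.Langlands.Langlands.Theorems.oddPrimesRegularFM_of_XZhang2024_tateTwist hXZ ℓ hℓ ρ
    hirr (isOdd_of_symplectic_odd ρ hsymp) hunr ?_ hcpt ι
  intro v hv
  refine ⟨(hdR v hv).1, fun τ hτ => ?_⟩
  obtain ⟨a, ha⟩ := (hdR v hv).2 τ hτ
  rw [ha]
  exact nodup_replicate_one_add a

/-- The floor item restricted: `OddPrimesRegularFM → SymplecticOddAbelianQ 1` (F3, item form). -/
theorem floor_one_of_item
    (h : Summit.Langlands.Langlands.Theses.DyadicOddResidue.OddPrimesRegularFM) :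
    SymplecticOddAbelianQ 1 := by
  intro ℓ _ hℓ ρ hirr hsymp hunr hdR hcpt ι
  refine h ℓ hℓ ρ hirr (isOdd_of_symplectic_odd ρ hsymp) hunr ?_ hcpt ι
  intro v hv
  refine ⟨(hdR v hv).1, fun τ hτ => ?_⟩
  obtain ⟨a, ha⟩ := (hdR v hv).2 τ hτ
  rw [ha]
  exact nodup_replicate_one_add a

end Floor

/-- **F3 special-case instance**: the family at the floor parameter `g = 1` IS (implied by) the floor. -/
example (hXZ : XZhang2024_fontaineMazurGL2_tateTwist) : SymplecticOddAbelianQ 1 := by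
  simpa [SymplecticOddAbelianQ] using floor_one hXZ

end Summit.Langlands.Langlands.Cruxes.ReciprocityUpToIrreducibility.SymplecticOddAbelianQ2.Special

end
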